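import Summits.QuantumFields.QCD.Theses.SpectralDefectExtinction
import Literature.MathematicalPhysics.QuantumFieldTheory.QCD
import Literature.Probability.LatticeModels.ThermodynamicLimit

/-!
# Stub `stub_denseBoxOfMass` (S2b) of the line `corner-decorrelation-deep-hole`
# (crux `WindowExtinction`, stmt-QuantumFields-18063)

DENSE BOX FROM SPREAD MASS — pure discrete analysis on the torus `(ℤ/L)⁴ = TorusSite 4 L`, no
gauge theory.  A site function `g` with small Dirichlet energy,
`Σ_{y,μ} (g y − g (y + μ̂))² ≤ η Σ g²`, at least `3/4` of whose squared mass is carried by a site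
set `A`, forces some integer box `∏ [a_i, a_i + ℓ)` with corner next to the support ball of `g` to
have at least a quarter of its points `v` with `A (proj v)`, as soon as `ℓ² η ≤ 1/128`.

## Proof (sliding boxes)

Write `D(τ) := Σ_v (g v − g (v + τ))²` for a torus translation `τ` and `E := Σ_μ D(μ̂)` for the
Dirichlet energy.

* `cornerDense_dispSq_sum_range_le` — telescoping + Cauchy–Schwarz + translation invariance of
  the counting measure: `D(u₀ + ⋯ + u_{N−1}) ≤ N Σ_k D(u_k)`.  Hence `D(n • e) ≤ n² D(e)`
  (`cornerDense_dispSq_nsmul_le`), `D(w₀+w₁+w₂+w₃) ≤ 4 Σ D(w_μ)` (`cornerDense_dispSq_sum_four_le`)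
  and, for an integer vector `t ∈ [0, ℓ)⁴`, `D(proj t) ≤ 4 Σ_μ t_μ² D(μ̂) ≤ 4ℓ² E`
  (`cornerDense_dispSq_proj_le`).
* `cornerDense_filter_sum_sq_le` — for every translation `τ`, reindexing the torus by `y ↦ y + τ`
  and using `b² ≤ 2a² + 2(a − b)²`:
  `Σ_{A} g² = Σ_y 1_A(y+τ) g(y+τ)² ≤ 2 Σ_y g(y)² 1_A(y+τ) + 2 D(τ)`.
* Summing the last display over the `ℓ⁴` translations `τ = proj t`, `t ∈ T := [0,ℓ)⁴ ⊂ ℤ⁴`: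
  `ℓ⁴ Σ_A g² ≤ 2 Σ_y g(y)² · #{t ∈ T : A(y + proj t)} + 2 ℓ⁴ · 4ℓ² E`.
  If every site `y` of the support of `g` had `4 · #{t ∈ T : A(y + proj t)} < ℓ⁴`, then, as
  `E ≤ η Σg²` and `ℓ²η ≤ 1/128`, the right side would be `< ℓ⁴ (1/2 + 1/16) Σ g² < ℓ⁴ · 3/4 Σ g²`
  (strictness from `Σ g² > 0`), a contradiction.  So some `y = x + proj w`, `w ∈ box(n+1)`, of
  the support has `ℓ⁴ ≤ 4 · #{t ∈ T : A(y + proj t)}`; its integer corner is `a := x̃ + w`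
  (`x̃_i = (x i).val`, so `proj a = y` and `x̃_i − n − 1 ≤ a_i ≤ x̃_i + n + 1`), all sides are
  `m_i = ℓ ∈ [ℓ, 2ℓ)`, and `#{v ∈ ∏[a_i, a_i+ℓ) : A(proj v)} = #{t ∈ T : A(proj a + proj t)}`
  (`cornerDense_card_box_filter`, translation by `a`; the count is taken in `ℤ⁴`, so no
  injectivity of `proj` is needed).

The hypotheses `g ≥ 0`, `2ℓ ≤ L` and `0 ≤ η` of the registered signature are not used.
-/

noncomputable section

namespace Summit.QuantumFields.QCD.Cruxes.WindowExtinction.CornerDecorrelationDeepHole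

open scoped BigOperators Topology Classical Matrix
open Filter MeasureTheory
open Literature.MathematicalPhysics.QuantumLattice Literature.MathematicalPhysics.QuantumFieldTheory
  Literature.Probability.LatticeModels

section Displacement

variable {G : Type*} [AddCommGroup G] [Fintype G]

/-- **Telescoping Cauchy–Schwarz for displacement energies.**  For a real function `g` on a finite
abelian group and steps `u₀, …, u_{N−1}`:
`Σ_v (g v − g (v + Σ_k u_k))² ≤ N · Σ_k Σ_v (g v − g (v + u_k))²`
(telescope along the partial sums, Cauchy–Schwarz in `k`, reindex each `k`-slice by a
translation). -/
theorem cornerDense_dispSq_sum_range_le (g : G → ℝ) (u : ℕ → G) (N : ℕ) :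
    ∑ v, (g v - g (v + ∑ k ∈ Finset.range N, u k)) ^ 2 ≤
      N * ∑ k ∈ Finset.range N, ∑ v, (g v - g (v + u k)) ^ 2 := by
  have htel : ∀ v, g v - g (v + ∑ k ∈ Finset.range N, u k) =
      ∑ k ∈ Finset.range N,
        (g (v + ∑ j ∈ Finset.range k, u j) - g (v + ∑ j ∈ Finset.range k, u j + u k)) := by
    intro v
    have h := Finset.sum_range_sub' (fun k => g (v + ∑ j ∈ Finset.range k, u j)) N
    rw [Finset.sum_range_zero, add_zero] at h
    rw [← h]
    refine Finset.sum_congr rfl fun k _ => ?_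
    rw [Finset.sum_range_succ, add_assoc]
  calc ∑ v, (g v - g (v + ∑ k ∈ Finset.range N, u k)) ^ 2
      = ∑ v, (∑ k ∈ Finset.range N,
          (g (v + ∑ j ∈ Finset.range k, u j) - g (v + ∑ j ∈ Finset.range k, u j + u k))) ^ 2 :=
        Finset.sum_congr rfl fun v _ => by rw [htel]
    _ ≤ ∑ v, ((N : ℝ) * ∑ k ∈ Finset.range N,
          (g (v + ∑ j ∈ Finset.range k, u j) - g (v + ∑ j ∈ Finset.range k, u j + u k)) ^ 2) := by
        refine Finset.sum_le_sum fun v _ => ?_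
        have h := sq_sum_le_card_mul_sum_sq (s := Finset.range N)
          (f := fun k => g (v + ∑ j ∈ Finset.range k, u j) - g (v + ∑ j ∈ Finset.range k, u j + u k))
        rwa [Finset.card_range] at h
    _ = N * ∑ k ∈ Finset.range N, ∑ v,
          (g (v + ∑ j ∈ Finset.range k, u j) - g (v + ∑ j ∈ Finset.range k, u j + u k)) ^ 2 := by
        rw [← Finset.mul_sum, Finset.sum_comm]
    _ = N * ∑ k ∈ Finset.range N, ∑ v, (g v - g (v + u k)) ^ 2 := by
        congr 1
        refine Finset.sum_congr rfl fun k _ => ?_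
        exact Fintype.sum_equiv (Equiv.addRight (∑ j ∈ Finset.range k, u j)) _ _ fun v => rfl

/-- `D(n • e) ≤ n² D(e)`: the displacement energy of an `n`-fold step. -/
theorem cornerDense_dispSq_nsmul_le (g : G → ℝ) (e : G) (n : ℕ) :
    ∑ v, (g v - g (v + n • e)) ^ 2 ≤ (n : ℝ) ^ 2 * ∑ v, (g v - g (v + e)) ^ 2 := by
  have h := cornerDense_dispSq_sum_range_le g (fun _ => e) n
  simp only [Finset.sum_const, Finset.card_range, nsmul_eq_mul] at h
  refine h.trans (le_of_eq ?_)
  ring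

/-- `D(w₀ + w₁ + w₂ + w₃) ≤ 4 Σ_μ D(w_μ)`. -/
theorem cornerDense_dispSq_sum_four_le (g : G → ℝ) (w : Fin 4 → G) :
    ∑ v, (g v - g (v + ∑ μ, w μ)) ^ 2 ≤ 4 * ∑ μ, ∑ v, (g v - g (v + w μ)) ^ 2 := by
  have h := cornerDense_dispSq_sum_range_le g (fun k => if hk : k < 4 then w ⟨k, hk⟩ else 0) 4
  rw [← Fin.sum_univ_eq_sum_range, ← Fin.sum_univ_eq_sum_range] at h
  simpa [Fin.is_lt] using h

/-- **Mass on `A` versus translated mass.**  For every translation `τ` of a finite abelian group: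
`Σ_{y ∈ A} g(y)² ≤ 2 Σ_y g(y)² 1_A(y + τ) + 2 Σ_v (g v − g (v + τ))²`. -/
theorem cornerDense_filter_sum_sq_le (g : G → ℝ) (A : G → Prop) (τ : G) :
    ∑ y ∈ (Finset.univ : Finset G).filter (fun y => A y), g y ^ 2 ≤
      2 * ∑ y, g y ^ 2 * (if A (y + τ) then 1 else 0) + 2 * ∑ v, (g v - g (v + τ)) ^ 2 := by
  rw [Finset.sum_filter, ← Fintype.sum_equiv (Equiv.addRight τ)
    (fun y => if A (y + τ) then g (y + τ) ^ 2 else 0) (fun y => if A y then g y ^ 2 else 0)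
    (fun _ => rfl), Finset.mul_sum, Finset.mul_sum, ← Finset.sum_add_distrib]
  refine Finset.sum_le_sum fun y _ => ?_
  split_ifs
  · nlinarith [sq_nonneg (2 * g y - g (y + τ))]
  · nlinarith [sq_nonneg (g y - g (y + τ))]

end Displacement

/-- A non-negative integer vector projects onto the torus as the corresponding combination of the
unit vectors `Pi.single μ 1`. -/
theorem cornerDense_proj_eq_sum_nsmul (L : ℕ) (t : Fin 4 → ℤ) (ht : ∀ i, 0 ≤ t i) :
    Torus.proj L t = ∑ μ, (t μ).toNat • (Pi.single μ (1 : ZMod L) : TorusSite 4 L) := by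
  ext i
  have hti : ((t i).toNat : ℤ) = t i := Int.toNat_of_nonneg (ht i)
  rw [Torus.proj_apply, Finset.sum_apply, Finset.sum_eq_single_of_mem i (Finset.mem_univ i)]
  · rw [Pi.smul_apply, Pi.single_eq_same, nsmul_one, ← Int.cast_natCast, hti]
  · intro μ _ hμ
    rw [Pi.smul_apply, Pi.single_eq_of_ne' hμ, smul_zero]

/-- **Displacement energy bound on the torus.**  For an integer vector `t ∈ [0, ℓ)⁴`:
`Σ_v (g v − g (v + proj t))² ≤ 4ℓ² · Σ_{y,μ} (g y − g (y + μ̂))²`. -/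
theorem cornerDense_dispSq_proj_le {L : ℕ} [NeZero L] (g : TorusSite 4 L → ℝ) (ℓ : ℕ)
    (t : Fin 4 → ℤ) (ht : ∀ i, 0 ≤ t i ∧ t i < ℓ) :
    ∑ v, (g v - g (v + Torus.proj L t)) ^ 2 ≤
      4 * (ℓ : ℝ) ^ 2 * ∑ y, ∑ μ : Fin 4, (g y - g (y + Pi.single μ 1)) ^ 2 := by
  rw [cornerDense_proj_eq_sum_nsmul L t fun i => (ht i).1, Finset.sum_comm, mul_assoc,
    Finset.mul_sum]
  refine (cornerDense_dispSq_sum_four_le g _).trans ?_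
  refine mul_le_mul_of_nonneg_left (Finset.sum_le_sum fun μ _ => ?_) (by norm_num)
  refine (cornerDense_dispSq_nsmul_le g _ _).trans ?_
  refine mul_le_mul_of_nonneg_right ?_ (Finset.sum_nonneg fun v _ => sq_nonneg _)
  have h : ((t μ).toNat : ℝ) ≤ ℓ := by
    have h1 : (t μ).toNat ≤ ℓ := by have := ht μ; omega
    exact_mod_cast h1
  exact pow_le_pow_left₀ (Nat.cast_nonneg _) h 2

/-- Translating the parameter box `[0,ℓ)⁴ ⊂ ℤ⁴` by an integer vector `a` identifies the count of
good points of the box `∏ [a_i, a_i + ℓ)` with a count over `[0,ℓ)⁴` seen from the torus site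
`proj a` (no injectivity of `proj` involved: both counts live in `ℤ⁴`). -/
theorem cornerDense_card_box_filter (L : ℕ) (A : TorusSite 4 L → Prop) (a : Fin 4 → ℤ) (ℓ : ℕ) :
    ((Fintype.piFinset fun _ : Fin 4 => Finset.Ico (0 : ℤ) ℓ).filter
        (fun t => A (Torus.proj L a + Torus.proj L t))).card =
      ((Fintype.piFinset fun i => Finset.Ico (a i) (a i + ℓ)).filter
        (fun v => A (Torus.proj L v))).card := by
  have hadd : ∀ t : Fin 4 → ℤ, Torus.proj L (a + t) = Torus.proj L a + Torus.proj L t := by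
    intro t; ext i; simp [Torus.proj]
  refine Finset.card_equiv (Equiv.addLeft a) fun t => ?_
  simp only [Finset.mem_filter, Fintype.mem_piFinset, Finset.mem_Ico, Equiv.coe_addLeft,
    Pi.add_apply, hadd]
  refine and_congr_left' (forall_congr' fun i => ⟨fun h => ⟨?_, ?_⟩, fun h => ⟨?_, ?_⟩⟩) <;> omega

/-- **S2b · DENSE BOX FROM SPREAD MASS (deterministic, generic lattice analysis).**  On the torus
`(ℤ/L)⁴`, let `g ≥ 0` be supported in the ball `x + proj(box(n+1))`, with Dirichlet energy
`Σ_{y,μ}(g(y) − g(y+μ̂))² ≤ η Σ g²`, and let `A` carry `≥ 3/4` of `Σ g²`.  If `2 ≤ ℓ`, `2ℓ ≤ L` and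
`ℓ²η ≤ 1/128`, some integer box `∏[a_i, a_i+m_i)` with `ℓ ≤ m_i < 2ℓ` and corner within
`[x̃_i − n − 2ℓ, x̃_i + n + 1]` (`x̃_i = (x i).val`) has at least a quarter of its points `v` with
`A(proj v)`.  Proof: sliding boxes of side exactly `ℓ` cornered at the support sites (module
docstring): the displacement energy bound `Σ_v (g v − g(v + proj t))² ≤ 4ℓ² · energy` for
`t ∈ [0,ℓ)⁴` and `b² ≤ 2a² + 2(a−b)²` give `ℓ⁴ Σ_A g² ≤ 2 Σ_y g(y)² #{t : A(y + proj t)} + 8ℓ⁶ η Σg²`,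
so not every support site can have `4 · #{t : A(y + proj t)} < ℓ⁴`. -/
theorem stub_denseBoxOfMass :
    ∀ (L : ℕ) [NeZero L] (g : TorusSite 4 L → ℝ) (A : TorusSite 4 L → Prop) (η : ℝ) (ℓ n : ℕ) (x : TorusSite 4 L),
    (∀ y, 0 ≤ g y) → 0 < ∑ y, g y ^ 2 → 2 ≤ ℓ → 2 * ℓ ≤ L → 0 ≤ η → (ℓ : ℝ) ^ 2 * η ≤ 1 / 128 →
    (∀ y, g y ≠ 0 → ∃ v ∈ box 4 (n + 1), y = x + Torus.proj L v) →
    (∑ y, ∑ μ : Fin 4, (g y - g (y + Pi.single μ 1)) ^ 2) ≤ η * ∑ y, g y ^ 2 →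
    3 / 4 * (∑ y, g y ^ 2) ≤ ∑ y ∈ (Finset.univ : Finset (TorusSite 4 L)).filter (fun y => A y), g y ^ 2 →
    ∃ a : Fin 4 → ℤ, (∀ i, ((x i).val : ℤ) - n - 2 * ℓ ≤ a i ∧ a i ≤ ((x i).val : ℤ) + n + 1) ∧
    ∃ m : Fin 4 → ℕ, (∀ i, ℓ ≤ m i ∧ m i < 2 * ℓ) ∧
    (∏ i, m i) ≤ 4 * ((Fintype.piFinset fun i => Finset.Ico (a i) (a i + m i)).filter
    (fun v => A (Torus.proj L v))).card := by
  intro L _ g A η ℓ n x _ hpos hℓ _ _ hℓη hsupp hE hA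
  -- the parameter box `T = [0, ℓ)⁴ ⊂ ℤ⁴` and the number of good translates of a site
  set T : Finset (Fin 4 → ℤ) := Fintype.piFinset fun _ : Fin 4 => Finset.Ico (0 : ℤ) ℓ with hT
  set cnt : TorusSite 4 L → ℕ := fun y => (T.filter fun t => A (y + Torus.proj L t)).card
    with hcnt
  have hTcard : T.card = ℓ ^ 4 := by
    rw [hT, Fintype.card_piFinset_const, Int.card_Ico, sub_zero, Int.toNat_natCast]
  have hTmem : ∀ t ∈ T, ∀ i, 0 ≤ t i ∧ t i < ℓ := by
    intro t ht i
    rw [hT, Fintype.mem_piFinset] at ht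
    simpa using ht i
  -- Fubini: summing the indicator over the translates first gives the counts
  have hswap : ∑ t ∈ T, ∑ y, g y ^ 2 * (if A (y + Torus.proj L t) then (1 : ℝ) else 0) =
      ∑ y, g y ^ 2 * (cnt y : ℝ) := by
    rw [Finset.sum_comm]
    refine Finset.sum_congr rfl fun y _ => ?_
    rw [← Finset.mul_sum, Finset.sum_boole]
  -- some site of the support is the corner of a good box of translates
  have hex : ∃ y, g y ≠ 0 ∧ ℓ ^ 4 ≤ 4 * cnt y := by
    by_contra hcon
    push Not at hcon
    -- (1) the weighted count is small: `4 S < ℓ⁴ Σ g²`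
    have hS : 4 * ∑ y, g y ^ 2 * (cnt y : ℝ) < (ℓ : ℝ) ^ 4 * ∑ y, g y ^ 2 := by
      rw [Finset.mul_sum, Finset.mul_sum]
      obtain ⟨y₀, -, hy₀⟩ := Finset.exists_ne_zero_of_sum_ne_zero hpos.ne'
      have hy₀' : g y₀ ≠ 0 := fun h => hy₀ (by simp [h])
      refine Finset.sum_lt_sum (fun y _ => ?_) ⟨y₀, Finset.mem_univ _, ?_⟩
      · by_cases hy : g y = 0
        · simp [hy]
        · have h' : (4 : ℝ) * cnt y ≤ (ℓ : ℝ) ^ 4 := by exact_mod_cast (hcon y hy).le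
          have := mul_le_mul_of_nonneg_left h' (sq_nonneg (g y))
          linarith
      · have h' : (4 : ℝ) * cnt y₀ < (ℓ : ℝ) ^ 4 := by exact_mod_cast hcon y₀ hy₀'
        have := mul_lt_mul_of_pos_left h' (by positivity : 0 < g y₀ ^ 2)
        linarith
    -- (2) the mass on `A` is controlled by the weighted count and the energy
    have hpt : ∀ t ∈ T, ∑ y ∈ (Finset.univ : Finset (TorusSite 4 L)).filter (fun y => A y), g y ^ 2 ≤
        2 * ∑ y, g y ^ 2 * (if A (y + Torus.proj L t) then (1 : ℝ) else 0) +
          2 * (4 * (ℓ : ℝ) ^ 2 * ∑ y, ∑ μ : Fin 4, (g y - g (y + Pi.single μ 1)) ^ 2) := by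
      intro t ht
      have h1 := cornerDense_filter_sum_sq_le g A (Torus.proj L t)
      have h2 := cornerDense_dispSq_proj_le g ℓ t (hTmem t ht)
      linarith
    have hsum := Finset.sum_le_sum hpt
    rw [Finset.sum_const, hTcard, Finset.sum_add_distrib, Finset.sum_const, hTcard,
      ← Finset.mul_sum, hswap, nsmul_eq_mul, nsmul_eq_mul, Nat.cast_pow] at hsum
    -- (3) arithmetic
    have hP : (0 : ℝ) < (ℓ : ℝ) ^ 4 := by positivity
    have h1 : (ℓ : ℝ) ^ 2 * ∑ y, ∑ μ : Fin 4, (g y - g (y + Pi.single μ 1)) ^ 2 ≤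
        (ℓ : ℝ) ^ 2 * (η * ∑ y, g y ^ 2) :=
      mul_le_mul_of_nonneg_left hE (by positivity)
    have h2 : (ℓ : ℝ) ^ 2 * η * ∑ y, g y ^ 2 ≤ 1 / 128 * ∑ y, g y ^ 2 :=
      mul_le_mul_of_nonneg_right hℓη hpos.le
    have h3 : (ℓ : ℝ) ^ 4 * (3 / 4 * ∑ y, g y ^ 2) ≤
        (ℓ : ℝ) ^ 4 * ∑ y ∈ (Finset.univ : Finset (TorusSite 4 L)).filter (fun y => A y), g y ^ 2 :=
      mul_le_mul_of_nonneg_left hA hP.le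
    have h4 : (ℓ : ℝ) ^ 4 * ((ℓ : ℝ) ^ 2 * ∑ y, ∑ μ : Fin 4, (g y - g (y + Pi.single μ 1)) ^ 2) ≤
        (ℓ : ℝ) ^ 4 * (1 / 128 * ∑ y, g y ^ 2) :=
      mul_le_mul_of_nonneg_left (by linarith) hP.le
    have h5 : 0 < (ℓ : ℝ) ^ 4 * ∑ y, g y ^ 2 := mul_pos hP hpos
    linarith
  -- place the corner
  obtain ⟨y, hy, hcnty⟩ := hex
  obtain ⟨w, hw, hyw⟩ := hsupp y hy
  rw [mem_box] at hw
  obtain ⟨a, ha⟩ : ∃ a : Fin 4 → ℤ, ∀ i, a i = ((x i).val : ℤ) + w i := ⟨_, fun _ => rfl⟩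
  obtain ⟨m, hm⟩ : ∃ m : Fin 4 → ℕ, ∀ i, m i = ℓ := ⟨fun _ => ℓ, fun _ => rfl⟩
  have hproja : Torus.proj L a = y := by
    rw [hyw]; ext i; simp [Torus.proj, ha]
  refine ⟨a, fun i => ?_, m, fun i => ?_, ?_⟩
  · have h := hw i; rw [ha]; constructor <;> omega
  · rw [hm]; constructor <;> omega
  · simp_rw [hm]
    rw [Finset.prod_const, Finset.card_univ, Fintype.card_fin,
      ← cornerDense_card_box_filter L A a ℓ, hproja]
    exact hcnty

end Summit.QuantumFields.QCD.Cruxes.WindowExtinction.CornerDecorrelationDeepHole
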